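import Literature.RepresentationTheory.MoeglinVignerasWaldspurger1987.RankOneThetaLiftTwistRigiditySplitProofs
import Literature.NumberTheory.Automorphic.Liu2021.SplitPlaceOscillatorModelUniform
import HarnessLib

/-!
# Row IV-4c4 DISCHARGED: `rankOne_theta_twist_rigidity_split` holds

Topic `RepresentationTheory/MoeglinVignerasWaldspurger1987`; THEOREMS ONLY.  The named fact
`rankOne_theta_twist_rigidity_split` (`RankOneThetaLiftTwistRigiditySplit.lean`, [Liu2021, App. D Lem. D.1 (3)] at a split
place: two splittings over `ι` with smooth `L²`-isometric Weil representations and `Θ_{s₁}(χ₁) ≅ Θ_{s₂}(χ₂) ≠ 0` are equal)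
is PROVED: `rankOne_theta_twist_rigidity_split_of_uniformModel` (`RankOneThetaLiftTwistRigiditySplitProofs.lean`: reduction
to one section + unitary twist, det-twists of parabolic induction, rigidity of the unitary inducing datum of
`(ν ∘ det) × χ′` for `N = 3`) applied to the UNIFORM split-place model
`Liu2021.splitPlace_chiCoinv_iso_parabolicIndGL_uniform` (`Liu2021/SplitPlaceOscillatorModelUniform.lean`: for every
section ONE `ν` serving all `χ`).  Cell hodgecm-mathlib, row IV-4c4 (binder `HypD3`, split places); unconditional;
HC_CM is proved only modulo the remaining printed citations until rung 0 closes.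

## References
* [Liu2021] Y. Liu, Camb. J. Math. 9 (2021) = arXiv:2102.11518 — App. D Lem. D.1 (3) (l. 5233); proof, split case (l. 5249–5254).
* [Minguez2008] A. Mínguez, Ann. Sci. ÉNS 41 (2008) — Thm. 1 p. 718, §6 p. 733.
-/

noncomputable section

namespace Literature.RepresentationTheory.MoeglinVignerasWaldspurger1987

/-- **[Liu2021, App. D Lem. D.1 (3)], `μ`-clause, `n = 3`, SPLIT place — PROVED.**  The named fact
`rankOne_theta_twist_rigidity_split` holds: `rankOne_theta_twist_rigidity_split_of_uniformModel` applied to the uniform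
split-place model `Liu2021.splitPlace_chiCoinv_iso_parabolicIndGL_uniform` (row IV-3(a), [Liu2021, App. D, split case];
[Minguez2008, Thm. 1]). [cite: Liu2021, App. D Lemma D.1 (3) (l. 5233) and proof, split case (l. 5249–5254)] -/
theorem rankOne_theta_twist_rigidity_split_holds : rankOne_theta_twist_rigidity_split :=
  rankOne_theta_twist_rigidity_split_of_uniformModel
    Literature.NumberTheory.Automorphic.Liu2021.splitPlace_chiCoinv_iso_parabolicIndGL_uniform

end Literature.RepresentationTheory.MoeglinVignerasWaldspurger1987

end
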